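import Literature.NumberTheory.Sieve.RosserSieveRecurrences
import Literature.NumberTheory.Sieve.RosserSieveHalfLemma18
import Literature.NumberTheory.Sieve.LinearSieveConstant
import Literature.NumberTheory.Sieve.SieveFunctionsBridge
import Literature.NumberTheory.Sieve.JurkatRichertMajorants
import HarnessLib

/-!
# The continuous models `f_n` of the linear sieve: Nathanson's Lemma 9.7 and `1 + Σ f_n ≤ 2e^γ/s`

Topic `Literature/NumberTheory/Sieve`; third file of the explicit form of the Jurkat–Richert
theorem following M. B. Nathanson, *Additive Number Theory: The Classical Bases*, GTM 164 (1996),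
Ch. 9, §9.3 (PDF pp. 154–157 of the held copy) [Nathanson1996]. Everything here is PROVED.

Nathanson's functions `f_n(s)` ((9.17), with the recursion of Lemma 9.5:
`s f_n(s) = ∫_s^∞ f_{n−1}(t − 1) dt` for `n` even, `s ≥ 2`, or `n` odd, `s ≥ 3`, and
`s f_n(s) = 3 f_n(3)` for `n` odd, `1 ≤ s ≤ 3`; `s f_1(s) = 3 − s` on `[1, 3]`, (9.20)) are, up to the
factor `s`, the continuous models of the tree: **`s f_n(s) = BetaSieve.contS 1 2 n s`** (Iwaniec's
`S_n(s)` for `κ = 1`, `β = 2`, `RosserSieveSums.lean`; the kernel `k_1(t) = (t − 1)⁻¹`,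
`sieveKernel_one`). In this normalisation we prove

* **Lemma 9.7** (`contS_le_majorant`): `s f_n(s) ≤ 2e² α^{n−1} s h(s)` for `n` odd and `s ≥ 1`, or
  `n` even and `s ≥ 2` (with `h = JurkatRichert.hFun` and `α = JurkatRichert.alphaN ≥` Nathanson's
  `α`, see `JurkatRichertMajorants.lean`), by Nathanson's induction from Lemma 9.6;
* the consequence of Theorem 9.8 that the upper bound needs, WITHOUT Nathanson's §9.5:
  `s + ∑_{n ≤ N, n odd} s f_n(s) ≤ 2e^γ` for `0 < s ≤ 3` (`add_contT_one_le`), i.e.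
  `1 + ∑_{n odd ≤ N} f_n(s) ≤ F(s) = 2e^γ/s`: this is Iwaniec's Lemma 18 (`T⁺_R(s) ≤ s(F(s) − 1)`,
  PROVED in the tree, `BetaSieve.Iwaniec1980_lemma18_holds`) for the linear-sieve data
  `(F_1, f_1, β_1 = 2, A_1 = 2e^γ)` (`isBetaSieveSolution_upperSieveFun_one`, `siftingLimit_one_holds`,
  `upperSieveFun_one_eq_holds`: `F_1(s) = 2e^γ/s` on `(0, 3]`).

## References

* M. B. Nathanson, *Additive Number Theory: The Classical Bases*, GTM 164, Springer (1996), Ch. 9,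
  (9.17)–(9.22), Lemma 9.5, Lemma 9.7, Theorem 9.4, Theorem 9.8. [Nathanson1996]
* H. Iwaniec, *Rosser's sieve*, Acta Arith. 36 (1980), 171–202, §7, Lemma 18. [IwaniecActaArith1980]
-/

open Set MeasureTheory intervalIntegral Real Finset

noncomputable section

namespace Literature.NumberTheory.Sieve

namespace JurkatRichert

open BetaSieve BetaSieveForward

/-! ### The kernel and the first model for `κ = 1`, `β = 2` -/

/-- `k_1(t) = (t − 1)⁻¹` for `t > 1` (the kernel of (7.1) in dimension `1`; Nathanson's recursion
(9.21) reads `s f_n(s) = ∫_s (t − 1)⁻¹ · (t − 1) f_{n−1}(t − 1) dt`). [cite: Nathanson1996, Lemma 9.5] -/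
theorem sieveKernel_one (t : ℝ) : sieveKernel 1 t = (t - 1)⁻¹ := by
  rw [sieveKernel, show (1 : ℝ) - 1 = 0 by norm_num, Real.rpow_zero, Real.rpow_neg_one]
  ring

/-- `S_1(s) = 3 − min(s, 3)`, i.e. `s f_1(s) = 3 − s` on `[1, 3]` and `f_1 = 0` beyond ((9.20)).
[cite: Nathanson1996, (9.20)] -/
theorem contS_one_one_two (s : ℝ) : contS 1 2 1 s = 3 - min s 3 := by
  rw [contS_one, Real.rpow_one, Real.rpow_one]; norm_num

/-- `0 ≤ S_n(s)` for `s ≥ 0`. [folklore] -/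
theorem contS_one_two_nonneg (n : ℕ) {s : ℝ} (hs : 0 ≤ s) : 0 ≤ contS 1 2 n s :=
  contS_nonneg zero_le_one (by norm_num) n hs

/-! ### Lemma 9.7: `s f_n(s) ≤ 2e² α^{n−1} s h(s)` -/

/-- The integrand bound in the induction step: if `S_{m+1}(u) ≤ C u h(u)` for `u ≥ s − 1` then
`∫_s^U k_1(t) S_{m+1}(t − 1) dt ≤ C ∫_{s−1}^{U−1} h` (`s > 1`, `U ≥ s`). [cite: Nathanson1996, Lemma 9.7 (proof)] -/
theorem integral_kernel_contS_le {m : ℕ} {s U C : ℝ} (hs : 1 < s) (hsU : s ≤ U)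
    (hIH : ∀ u : ℝ, s - 1 ≤ u → contS 1 2 (m + 1) u ≤ C * (u * hFun u)) :
    ∫ t in s..U, sieveKernel 1 t * contS 1 2 (m + 1) (t - 1) ≤ C * ∫ u in (s - 1)..(U - 1), hFun u := by
  have hint1 : IntervalIntegrable (fun t => sieveKernel 1 t * contS 1 2 (m + 1) (t - 1)) volume s U :=
    intervalIntegrable_sieveKernel_mul (continuous_contS zero_le_one (by norm_num) (m + 1)) hs hsU
  have hint2 : IntervalIntegrable (fun t => C * hFun (t - 1)) volume s U :=
    ((continuous_hFun.comp (continuous_id.sub continuous_const)).intervalIntegrable _ _).const_mul C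
  calc ∫ t in s..U, sieveKernel 1 t * contS 1 2 (m + 1) (t - 1)
      ≤ ∫ t in s..U, C * hFun (t - 1) := by
        refine intervalIntegral.integral_mono_on hsU hint1 hint2 fun t ht => ?_
        have htm : 0 < t - 1 := by linarith [hs.trans_le ht.1]
        rw [sieveKernel_one]
        have h := hIH (t - 1) (by linarith [ht.1])
        calc (t - 1)⁻¹ * contS 1 2 (m + 1) (t - 1) ≤ (t - 1)⁻¹ * (C * ((t - 1) * hFun (t - 1))) :=
              mul_le_mul_of_nonneg_left h (inv_nonneg.mpr htm.le)
          _ = C * hFun (t - 1) := by field_simp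
    _ = C * ∫ t in s..U, hFun (t - 1) := by rw [intervalIntegral.integral_const_mul]
    _ = C * ∫ u in (s - 1)..(U - 1), hFun u := by
        rw [intervalIntegral.integral_comp_sub_right (fun u => hFun u) 1]

/-- **Lemma 9.7** (Nathanson): in the normalisation `S_n = s f_n`,
`S_n(s) ≤ 2e² α^{n−1} s h(s)` for `n ≥ 1` odd and `s ≥ 1`, or `n ≥ 2` even and `s ≥ 2`. Proof as
printed: `n = 1` from (9.20); the step from the recursion (9.21)/(9.22)
(`BetaSieve.contS_succ_succ_eq_integral`, `contS_odd_eq_of_le`) and Lemma 9.6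
(`integral_hFun_le_alphaN`, `integral_hFun_two_le_alphaN`). [cite: Nathanson1996, Lemma 9.7] -/
theorem contS_le_majorant : ∀ (n : ℕ) (s : ℝ), 1 ≤ n → (n % 2 = 1 → 1 ≤ s) → (n % 2 = 0 → 2 ≤ s) →
    contS 1 2 n s ≤ 2 * Real.exp 2 * alphaN ^ (n - 1) * (s * hFun s)
  | 0, _, h, _, _ => absurd h (by norm_num)
  | 1, s, _, hodd, _ => by
    have hs : 1 ≤ s := hodd rfl
    rw [contS_one_one_two, pow_zero, mul_one]
    have he2 : Real.exp 2 * Real.exp (-2) = 1 := by rw [← Real.exp_add]; norm_num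
    rcases le_or_gt s 2 with h2 | h2
    · -- `3 - s ≤ 2 ≤ 2 s = 2e² s e^{-2}`
      rw [min_eq_left (by linarith), hFun_of_le_two h2]
      nlinarith
    rcases le_or_gt s 3 with h3 | h3
    · -- `3 - s ≤ 1 ≤ 4 e^{-1} ≤ 2 e^{2-s} s`
      rw [min_eq_left h3, hFun_of_mem h2.le h3]
      have h1 : Real.exp (-1) ≤ Real.exp (2 + -s) := Real.exp_le_exp.mpr (by linarith)
      rw [Real.exp_add] at h1
      have := Real.exp_neg_one_gt_d9
      nlinarith [Real.exp_pos (-s), Real.exp_pos (2 : ℝ)]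
    · rw [min_eq_right h3.le, sub_self]
      have := hFun_pos s
      positivity
  | m + 2, s, _, hodd, heven => by
    have hC : (0 : ℝ) ≤ 2 * Real.exp 2 * alphaN ^ m := by
      have := alphaN_pos; positivity
    have hα0 := alphaN_pos
    -- the induction hypothesis for `m + 1`, packaged for `integral_kernel_contS_le`
    have IH : ∀ u : ℝ, ((m + 1) % 2 = 1 → 1 ≤ u) → ((m + 1) % 2 = 0 → 2 ≤ u) →
        contS 1 2 (m + 1) u ≤ 2 * Real.exp 2 * alphaN ^ m * (u * hFun u) := fun u h1 h2 => by
      have := contS_le_majorant (m + 1) u (by omega) h1 h2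
      simpa using this
    rw [show m + 2 - 1 = m + 1 from rfl, pow_succ]
    rcases Nat.even_or_odd m with ⟨k, hk⟩ | ⟨k, hk⟩
    · -- `n = m + 2` even, `s ≥ 2`; `m + 1` odd
      have hm0 : m % 2 = 0 := by omega
      have hs : 2 ≤ s := heven (by omega)
      have hrec := contS_succ_succ_eq_integral (κ := 1) zero_le_one (by norm_num : (1 : ℝ) < 2) m
        (s := s) (U := max s (2 + m + 2))
        (by rw [parityShift_of_even hm0]; linarith) le_rfl
      rw [hrec]
      have hsU : s ≤ max s (2 + m + 2) := le_max_left _ _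
      have hstep := integral_kernel_contS_le (m := m) (by linarith) hsU
        (fun u hu => IH u (fun _ => by linarith) (fun h => by omega))
      have h96 := integral_hFun_le_alphaN hs (T := max s (2 + ↑m + 2) - 1) (by linarith)
      calc _ ≤ 2 * Real.exp 2 * alphaN ^ m * ∫ u in (s - 1)..(max s (2 + ↑m + 2) - 1), hFun u := hstep
        _ ≤ 2 * Real.exp 2 * alphaN ^ m * (alphaN * s * hFun s) := mul_le_mul_of_nonneg_left h96 hC
        _ = 2 * Real.exp 2 * (alphaN ^ m * alphaN) * (s * hFun s) := by ring
    · -- `n = m + 2` odd; `m + 1` even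
      have hm1 : m % 2 = 1 := by omega
      have hs1 : 1 ≤ s := hodd (by omega)
      -- the value at `max s 3`: recursion from `3` (for `s ≤ 3`, `S_n(s) = S_n(3)`)
      set s' := max s 3 with hs'
      have hs'3 : 3 ≤ s' := le_max_right _ _
      have heq : contS 1 2 (m + 2) s = contS 1 2 (m + 2) s' := by
        rcases le_or_gt s 3 with h3 | h3
        · rw [show s' = 3 from max_eq_right h3]
          have := contS_odd_eq_of_le (κ := 1) (β := 2) (n := m + 2) (by omega) (by omega) (s := s)
            (by norm_num; exact h3)
          norm_num at this
          exact this
        · rw [show s' = s from max_eq_left h3.le]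
      have hrec := contS_succ_succ_eq_integral (κ := 1) zero_le_one (by norm_num : (1 : ℝ) < 2) m
        (s := s') (U := max s' (2 + m + 2))
        (by rw [parityShift_of_odd hm1]; linarith) le_rfl
      rw [heq, hrec]
      have hsU : s' ≤ max s' (2 + m + 2) := le_max_left _ _
      have hstep := integral_kernel_contS_le (m := m) (s := s') (by linarith) hsU
        (fun u hu => IH u (fun h => by omega) (fun _ => by linarith))
      -- Lemma 9.6 in the two ranges
      have h96 : ∫ u in (s' - 1)..(max s' (2 + ↑m + 2) - 1), hFun u ≤ alphaN * s * hFun s := by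
        rcases le_or_gt s 3 with h3 | h3
        · have hs'e : s' = 3 := max_eq_right h3
          rw [hs'e, show (3 : ℝ) - 1 = 2 by norm_num]
          exact integral_hFun_two_le_alphaN hs1 h3 (by
            have := le_max_left (3 : ℝ) (2 + ↑m + 2); linarith)
        · have hs'e : s' = s := max_eq_left h3.le
          rw [hs'e]
          exact integral_hFun_le_alphaN (by linarith) (by
            have := le_max_left s (2 + ↑m + 2); linarith)
      calc _ ≤ 2 * Real.exp 2 * alphaN ^ m * ∫ u in (s' - 1)..(max s' (2 + ↑m + 2) - 1), hFun u := hstep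
        _ ≤ 2 * Real.exp 2 * alphaN ^ m * (alphaN * s * hFun s) := mul_le_mul_of_nonneg_left h96 hC
        _ = 2 * Real.exp 2 * (alphaN ^ m * alphaN) * (s * hFun s) := by ring

/-- Lemma 9.7 for odd `n` in terms of the odd majorant: `S_n(s) ≤ 2e³ α^{n−1} s m_o(s)` (`s ≥ 1`;
`h ≤ e m_o`). [cite: Nathanson1996, Lemma 9.7] -/
theorem contS_le_majorant_odd {n : ℕ} (hn : n % 2 = 1) {s : ℝ} (hs : 1 ≤ s) :
    contS 1 2 n s ≤ 2 * Real.exp 3 * alphaN ^ (n - 1) * (s * moFun s) := by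
  have h := contS_le_majorant n s (by omega) (fun _ => hs) (fun h => by omega)
  have h2 : s * hFun s ≤ s * (Real.exp 1 * moFun s) :=
    mul_le_mul_of_nonneg_left (hFun_le_exp_one_mul_moFun s) (by linarith)
  have hα : 0 ≤ alphaN ^ (n - 1) := pow_nonneg alphaN_pos.le _
  have he : Real.exp 3 = Real.exp 2 * Real.exp 1 := by rw [← Real.exp_add]; norm_num
  calc contS 1 2 n s ≤ 2 * Real.exp 2 * alphaN ^ (n - 1) * (s * hFun s) := h
    _ ≤ 2 * Real.exp 2 * alphaN ^ (n - 1) * (s * (Real.exp 1 * moFun s)) :=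
        mul_le_mul_of_nonneg_left h2 (by positivity)
    _ = 2 * Real.exp 3 * alphaN ^ (n - 1) * (s * moFun s) := by rw [he]; ring

/-- Lemma 9.7 for even `n` (`s ≥ 2`): `S_n(s) ≤ 2e² α^{n−1} s h(s)`. [cite: Nathanson1996, Lemma 9.7] -/
theorem contS_le_majorant_even {n : ℕ} (hn : n % 2 = 0) (hn1 : 1 ≤ n) {s : ℝ} (hs : 2 ≤ s) :
    contS 1 2 n s ≤ 2 * Real.exp 2 * alphaN ^ (n - 1) * (s * hFun s) :=
  contS_le_majorant n s hn1 (fun h => by omega) (fun _ => hs)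

/-! ### `1 + Σ_{n odd} f_n(s) ≤ 2e^γ/s` on `(0, 3]` (from Lemma 18 and Theorem 9.8 of the tree) -/

/-- The linear-sieve data `(F_1, f_1, β_1, A_1)` of the tree are greatest `β`-sieve data of
dimension `1` (for `κ = 1` all normalised solutions have `β = 2`). [folklore] -/
theorem isGreatestBetaSieveData_linear :
    IsGreatestBetaSieveData 1 (upperSieveFun 1, lowerSieveFun 1, siftingLimit 1, betaSieveConst 1) :=
  (isGreatestBetaSieveData_one_iff _).mpr isBetaSieveSolution_upperSieveFun_one

/-- **`s + T⁺_N(s) ≤ 2e^γ` for `0 < s ≤ 3`**, i.e. `1 + ∑_{n ≤ N, n odd} f_n(s) ≤ F(s) = 2e^γ/s`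
(Nathanson's (9.27) `F = 1 + Σ_{n odd} f_n` together with Theorem 9.8 `F(s) = 2e^γ/s`; here from
Iwaniec's Lemma 18, `BetaSieve.Iwaniec1980_lemma18_holds`, for the data
`(F_1, f_1, 2, 2e^γ)` and `upperSieveFun_one_eq_holds`). [cite: Nathanson1996, Thm 9.4 (9.27) and Thm 9.8] -/
theorem add_contT_one_le (N : ℕ) {s : ℝ} (hs : 0 < s) (hs3 : s ≤ 3) :
    s + contT 1 1 2 N s ≤ 2 * Real.exp Real.eulerMascheroniConstant := by
  have h18 := Iwaniec1980_lemma18_holds.upper_of_pos (by norm_num : (1 : ℝ) / 2 ≤ 1)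
    isGreatestBetaSieveData_linear N hs
  dsimp only at h18
  rw [show siftingLimit 1 = 2 from siftingLimit_one_holds, Real.rpow_one,
    upperSieveFun_one_eq_holds ⟨hs, hs3⟩] at h18
  have : s * (2 * Real.exp Real.eulerMascheroniConstant / s - 1) =
      2 * Real.exp Real.eulerMascheroniConstant - s := by field_simp
  linarith

end JurkatRichert

end Literature.NumberTheory.Sieve
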